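import Summits.ValiantsHypothesis.ValiantsHypothesis.Theorems.MonotoneRestorationOrbitRestorationQPGradedCatalecticant
import HarnessLib

/-!
# Polynomial catalecticant rank ⇒ quasi-polynomial orbit restoration, without homogeneity (unconditional)

Route MonotoneRestoration, crux `OrbitRestorationQP` (stmt-ValiantsHypothesis-18293), line `depth-three-rung`,
stub A_∞ `stub_sigmaPiSigmaValue`.  Namespace `Summit.ValiantsHypothesis.ValiantsHypothesis.Theorems.DerivativeTower`.

`…GradedCatalecticant.lean` assumed small derivative spaces for every HOMOGENEOUS COMPONENT.  Here we remove the
detour: partial derivatives commute with taking components (`pderiv_homogeneousComponent`), so the derivative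
chain of a component is a projection of the derivative chain of `f` (`derivChain_homogeneousComponent_le`) and
is no bigger (`finrank_derivChain_homogeneousComponent_le`).  Consequently

* `catalecticant_restoration` — **for every `c` there is `c'` such that EVERY matrix-symmetric family `f` with
  all derivative spaces `derivChain (f n) m` of dimension `≤ n^c + c` (polynomial catalecticant rank, `f n` of
  any degree, not necessarily homogeneous) satisfies `QPOrbitRestorable c' n (f n)` for all `n`.**

Honest label: a stratum of stub A_∞ (contains ΣΛΣ over affine forms); ΣΠΣ with many distinct forms per
product (exponential catalecticant rank), A_∞, the crux and VP ≠ VNP remain open. [folklore]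
-/

noncomputable section

open scoped Classical

-- `Summit.ValiantsHypothesis.ValiantsHypothesis.…` is the tree's single-conjunct layout (Sub = Summit).
set_option linter.dupNamespace false

namespace Summit.ValiantsHypothesis.ValiantsHypothesis.Theorems

namespace DerivativeTower

open MvPolynomial Finset Equiv OrbitRestorationQPDepthThreeRung WaringJennrich LevelStructure

variable {n : ℕ}

/-- Partial derivatives commute with homogeneous components, shifting the degree by one (adapted from the
private lemma of `Literature/AlgebraicGeometry/Resolution/WeightedCentreUmbrellaParityFree.lean`). [folklore] -/
theorem pderiv_homogeneousComponent (x : Fin n × Fin n) {j : ℕ} (hj : 1 ≤ j)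
    (f : MvPolynomial (Fin n × Fin n) ℂ) :
    pderiv x (homogeneousComponent j f) = homogeneousComponent (j - 1) (pderiv x f) := by
  ext β
  simp only [coeff_pderiv, coeff_homogeneousComponent]
  have hdeg : (β + Finsupp.single x 1).degree = β.degree + 1 := by
    rw [map_add, Finsupp.degree_single]
  by_cases h : β.degree = j - 1
  · rw [if_pos h, if_pos (by rw [hdeg]; omega)]
  · rw [if_neg h, if_neg (by rw [hdeg]; omega), zero_mul]

/-- The degree-`0` component has vanishing partial derivatives. [folklore] -/
theorem pderiv_homogeneousComponent_zero (x : Fin n × Fin n) (f : MvPolynomial (Fin n × Fin n) ℂ) :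
    pderiv x (homogeneousComponent 0 f) = 0 := by
  rw [homogeneousComponent_zero, pderiv_C]

/-- **The derivative chain of a homogeneous component is a projection of the derivative chain of `f`.**
[folklore] -/
theorem derivChain_homogeneousComponent_le (f : MvPolynomial (Fin n × Fin n) ℂ) (e : ℕ) :
    ∀ m : ℕ, derivChain (homogeneousComponent e f) m ≤
      (derivChain f m).map (homogeneousComponent (e - m) :
        MvPolynomial (Fin n × Fin n) ℂ →ₗ[ℂ] MvPolynomial (Fin n × Fin n) ℂ)
  | 0 => by
      show Submodule.span ℂ {homogeneousComponent e f} ≤ (Submodule.span ℂ {f}).map _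
      rw [Submodule.map_span, Set.image_singleton, Nat.sub_zero]
  | m + 1 => by
      show Submodule.span ℂ {q | ∃ (x : Fin n × Fin n) (p : MvPolynomial (Fin n × Fin n) ℂ),
          p ∈ derivChain (homogeneousComponent e f) m ∧ q = pderiv x p} ≤ _
      rw [Submodule.span_le]
      rintro _ ⟨x, p, hp, rfl⟩
      obtain ⟨q, hq, rfl⟩ := Submodule.mem_map.mp (derivChain_homogeneousComponent_le f e m hp)
      rw [SetLike.mem_coe]
      by_cases hem : e - m = 0
      · rw [hem, pderiv_homogeneousComponent_zero]
        exact Submodule.zero_mem _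
      · rw [pderiv_homogeneousComponent x (by omega), show e - m - 1 = e - (m + 1) by omega]
        exact Submodule.mem_map_of_mem (pderiv_mem_derivChain hq x)

/-- The derivative chain of a component is finite-dimensional of no larger dimension. [folklore] -/
theorem finrank_derivChain_homogeneousComponent_le (f : MvPolynomial (Fin n × Fin n) ℂ) (e m : ℕ)
    [FiniteDimensional ℂ (derivChain f m)] :
    FiniteDimensional ℂ (derivChain (homogeneousComponent e f) m) ∧
      Module.finrank ℂ (derivChain (homogeneousComponent e f) m) ≤ Module.finrank ℂ (derivChain f m) := by
  have hle := derivChain_homogeneousComponent_le f e m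
  refine ⟨Submodule.finiteDimensional_of_le hle, ?_⟩
  exact (Submodule.finrank_mono hle).trans (Submodule.finrank_map_le _ _)

/-- **POLYNOMIAL CATALECTICANT RANK ⇒ QUASI-POLYNOMIAL ORBIT RESTORATION (unconditional, any degree, one
constant per class).**  For every `c` there is `c'` such that every matrix-symmetric family `f` with
`finrank (derivChain (f n) m) ≤ n^c + c` for all `n, m` satisfies `QPOrbitRestorable c' n (f n)` for all `n`.
[folklore] -/
theorem catalecticant_restoration (c : ℕ) : ∃ c' : ℕ,
    ∀ f : (n : ℕ) → MvPolynomial (Fin n × Fin n) ℂ, IsMatrixSymmetric f →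
      (∀ n m, FiniteDimensional ℂ (derivChain (f n) m) ∧ Module.finrank ℂ (derivChain (f n) m) ≤ n ^ c + c) →
      ∀ n : ℕ, QPOrbitRestorable c' n (f n) := by
  obtain ⟨c', hc'⟩ := smallGradedDerivChain_restoration c
  refine ⟨c', fun f hsym hrank n => hc' f hsym (fun n e m => ?_) n⟩
  haveI := (hrank n m).1
  have h := finrank_derivChain_homogeneousComponent_le (f n) e m
  exact ⟨h.1, h.2.trans (hrank n m).2⟩

end DerivativeTower

end Summit.ValiantsHypothesis.ValiantsHypothesis.Theorems

end
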